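/-
Copyright (c) 2026. All rights reserved.
Released under Apache 2.0 license as described in the file LICENSE.
Authors: HodgeCM publication cell (pub-hodgecm), floor-0 programme P4, prover `F0P4-p04`.
-/
import Literature.NumberTheory.Weil1964.AdelicMetaplecticUnitaryLegContinuity
import Literature.NumberTheory.Weil1964.AdelicMetaplecticRationalLift
import HarnessLib

/-!
# Weil's `r_F` is `L²`-isometric: the Θ-fixing lifts of the rational symplectic group have `L²` scaling `1`

Topic `NumberTheory/Weil1964`; namespace `Literature.NumberTheory.Weil1964`.  KERNEL ONLY: theorems, no definition,
nothing of [Weil1964] or [GelbartRogawski1991] asserted; no Literature fact is introduced or consumed.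

Recall the objects of record (number field `F`, `n : ℕ`, invertible Gram matrix `T ∈ GL_n(𝔸_F)`, additive Haar
measure `ν` on `X_𝔸 = 𝔸_Fⁿ`):
* `adelicMpCont F (Fin n) T = Mp_ψ(W_𝔸)ᶜᵒⁿᵗ`, the pairs `(g, M)` with `M` an LF-continuous automorphism of the smooth model
  `𝒮(𝔸_Fⁿ)` implementing `g ∈ Sp(W_𝔸)` (`AdelicMetaplecticContinuous`); its kernel over `Sp(W_𝔸)` is `ℂˣ`
  (`AdelicMetaplecticKernel`) — NOT print's `S¹`: the operators are not normalised to be unitary;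
* `adelicMpCont.l2Scaling F T hT ν p ∈ (0, ∞)`, THE constant with `∫⁻ ‖ω(p)Φ‖ₑ² dν = l2Scaling p · ∫⁻ ‖Φ‖ₑ² dν` for all
  `Φ ∈ 𝒮(𝔸_Fⁿ)` (`AdelicMetaplecticL2Scalar`, `AdelicMetaplecticUnitaryLegContinuity` §2), multiplicative in `p`;
* `ratThetaLiftCont F T hT : Sp_{2n}(F) →* Mp_ψ(W_𝔸)ᶜᵒⁿᵗ`, Weil's `r_F` / Gelbart–Rogawski's `i`: the unique Θ-fixing
  LF-continuous pair over each rational point (`AdelicMetaplecticGenerators` §4), with its arbitrary-index forms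
  `ratThetaLiftContι`, `ratPointsThetaLiftCont` (`AdelicMetaplecticRationalLift`).

MAIN THEOREM **`adelicMpCont.l2Scaling_ratThetaLiftCont`**: `l2Scaling ν (r_F γ) = 1` for every `γ ∈ Sp_{2n}(F)` and
EVERY additive Haar measure `ν` — the Θ-fixing lifts of the rational points are `L²(ν)`-ISOMETRIC on `𝒮(𝔸_Fⁿ)`:
`∫⁻ ‖ω(r_F γ)Φ‖ₑ² dν = ∫⁻ ‖Φ‖ₑ² dν` (`adelicMpCont.lintegral_enorm_sq_omega_ratThetaLiftCont`).  In print this is built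
into the definitions ([Weil1964, Chap. I n° 13 p. 160]: the generators `d(α)`, `t(f)`, `d'(γ)` act by UNITARY operators
of `L²(X)`; Chap. III n° 40 p. 190: `r_k(σ) ∈ Mp(X_A)`, a group of unitary operators); in the tree's `ℂˣ`-extension it is
a theorem, and it is the missing input «L★» of the `L²`-unitarity (`hiso`) of a COMPATIBLE pair splitting
([GelbartRogawski1991, Prop. 3.1.1]: `s(G(F)) ⊆ i(Sp_F(W))`) consumed by [Li1992, Thm 2.1] as stated in
`Literature/NumberTheory/Li1992/RallisInnerProductThetaLift.lean`, and of the compatibility of the `L²`-renormalised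
splitting `s ⊗ (l2Scaling ∘ s)^{-1/2}` (`SplittingDatum.IsCompatible.of_central_twist` wants triviality on rational points).

PROOF (generator bookkeeping the tree already owns): `γ ↦ l2Scaling ν (r_F γ)` is multiplicative
(`adelicMpCont.l2Scaling_mul`, `r_F` a homomorphism), so `{γ | l2Scaling (r_F γ) = 1}` is a subgroup of `Sp_{2n}(F)`; it
contains Weil's generators — the Levi elements `m(γ)`, `γ ∈ GL_n(F)` (`coe_ratThetaLiftCont_levi`: the operator is
`Φ ↦ Φ ∘ γ⁻¹`, of `L²` module `|det γ|_𝔸⁻¹ = 1` by the PRODUCT FORMULA, `lintegral_enorm_sq_twist` + `ideleNorm_principal`),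
the unipotents `v(σ)`, `σ ∈ Sym_n(F)` (`coe_ratThetaLiftCont_low`: a unimodular chirp, `lintegral_enorm_sq_chirp`) and the
Weyl element `J` (`coe_ratThetaLiftCont_J`: `Φ ↦ Φ̂(-·)` for a self-dual measure, isometric for EVERY Haar `ν` by the adelic
Plancherel formula, `lintegral_enorm_sq_adelicPiFourier_neg`) — hence is everything (`SymplecticMatrix.eq_top_of_generators_mem'`,
generation of `Sp_{2n}` over a field by the Siegel parabolic and `J`, [MoeglinVignerasWaldspurger1987, Chap. 2 II.5]).

## What is here (sorry-free)
* §1 the `L²` scaling read off: `l2Scaling_eq_of_forall` (uniqueness), `l2Scaling_one`, `l2Scaling_inv`,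
  `lintegral_enorm_sq_omega_eq_of_l2Scaling_eq_one`;
* §2 the scalings of the three generator families for ADELIC parameters: `l2Scaling_leviPair = |det a|_𝔸⁻¹`
  (stated as `adelicAbsDet n F (trInv a)⁻¹`, the module of the row-vector twist by `(a⁻¹)ᵀ`), `l2Scaling_unipPair = 1`,
  `l2Scaling_weylPair = 1`; the product formula `adelicAbsDet_ratGL : |det γ|_𝔸 = 1` for `γ ∈ GL_n(F)`;
* §3 the rational generators `l2Scaling_ratThetaLiftCont_levi/_low/_J = 1` and the MAIN THEOREM, with its consumer forms:
  `lintegral_enorm_sq_omega_ratThetaLiftCont` (`∫⁻ ‖ω(r_F γ)Φ‖ₑ² = ∫⁻ ‖Φ‖ₑ²`), the range form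
  `l2Scaling_eq_one_of_mem_range_ratThetaLiftCont`, the Θ-RIGID form `l2Scaling_eq_one_of_mem_adelicMpTheta` (a Θ-fixing
  LF-continuous pair over a rational point of `Sp(W_𝔸)` is `L²`-isometric — the shape a compatible splitting delivers its
  rational values in), and the arbitrary-index forms `l2Scaling_ratThetaLiftContι`, `l2Scaling_ratPointsThetaLiftCont`.

NOT here: the assembly «`l2Scaling ∘ s ≡ 1` for a continuous compatible splitting `s` of a unitary dual pair» (continuity
`continuous_l2Scaling_comp_hom` + this file on rational points + factorisation through `det` + compactness of `[U(1)]`),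
which lives on the `GelbartRogawski1991` side.

## References
* [Weil1964] A. Weil, *Sur certains groupes d'opérateurs unitaires*, Acta Math. 111 (1964) 143–211, Chap. I n° 13 p. 160
  (the unitary operators of the generators), Chap. III n° 37 p. 188, n° 40 p. 190 (`r_k`), n° 41 Thm 6 p. 193.
* [GelbartRogawski1991] S. Gelbart, J. Rogawski, Invent. Math. 105 (1991) 445–472, §3.1 p. 454 (`i : Sp(𝕎)(k) → Mp(𝕎)`),
  Prop. 3.1.1 p. 455 (compatible splittings).
* [MoeglinVignerasWaldspurger1987] C. Mœglin, M.-F. Vignéras, J.-L. Waldspurger, LNM 1291 (1987), Chap. 2 II.5 (generation),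
  II.6 (the operators of the generators).
* [WeilBNT1967] A. Weil, *Basic Number Theory* (1967), Ch. IV §3 Cor. 1 of Prop. 3 (module of an automorphism), §4 Thm 5
  (product formula).
* [CasselsFrohlichANT1967] J. Tate, in Cassels–Fröhlich (eds.), *Algebraic Number Theory* (1967), Ch. XV Thm 4.1.2 (Plancherel).
-/

set_option autoImplicit false

noncomputable section

open scoped Matrix ENNReal NNReal
open NumberField MeasureTheory MeasureTheory.Measure

namespace Literature.NumberTheory.Weil1964

open Literature.NumberTheory.Automorphic Literature.RepresentationTheory.HeisenbergGroup
  Literature.RepresentationTheory.HeisenbergGroup.SymplecticMatrix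

variable (F : Type) [Field F] [NumberField F] {n : ℕ}
variable (T : Matrix (Fin n) (Fin n) (AdeleRing (𝓞 F) F)) (hT : IsUnit T.det)
variable [MeasurableSpace (AdeleRing (𝓞 F) F)] [BorelSpace (AdeleRing (𝓞 F) F)]
  (ν : Measure (Fin n → AdeleRing (𝓞 F) F)) [ν.IsAddHaarMeasure]

/-! ## §1 Reading off the `L²` scaling -/

section ReadOff

omit [BorelSpace (AdeleRing (𝓞 F) F)] [ν.IsAddHaarMeasure] in
/-- transport of the `L²(ν)` functional along an identification of underlying functions. [folklore] -/
private theorem lintegral_enorm_sq_congr_coe {Ψ : piSchwartzBruhat F (Fin n)} {f : (Fin n → AdeleRing (𝓞 F) F) → ℂ}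
    (e : ((Ψ : piSchwartzBruhat F (Fin n)) : (Fin n → AdeleRing (𝓞 F) F) → ℂ) = f) :
    ∫⁻ x, ‖(Ψ : (Fin n → AdeleRing (𝓞 F) F) → ℂ) x‖ₑ ^ 2 ∂ν = ∫⁻ x, ‖f x‖ₑ ^ 2 ∂ν :=
  e ▸ rfl

/-- **the `L²` scaling is read off any constant that works**: if `∫⁻ ‖ω(p)Φ‖ₑ² dν = c · ∫⁻ ‖Φ‖ₑ² dν` for all
`Φ ∈ 𝒮(𝔸_Fⁿ)` then `l2Scaling ν p = c` (uniqueness of the scalar, `lintegral_enorm_sq_omega_scalar_unique`).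
[cite: Weil1964, Chap. I n° 13 p. 160] -/
theorem adelicMpCont.l2Scaling_eq_of_forall (p : adelicMpCont F (Fin n) T) {c : ℝ≥0∞}
    (hc : ∀ Φ : piSchwartzBruhat F (Fin n),
      ∫⁻ x, ‖((adelicMpCont.omega F (Fin n) T p Φ : piSchwartzBruhat F (Fin n)) :
          (Fin n → AdeleRing (𝓞 F) F) → ℂ) x‖ₑ ^ 2 ∂ν =
        c * ∫⁻ x, ‖(Φ : (Fin n → AdeleRing (𝓞 F) F) → ℂ) x‖ₑ ^ 2 ∂ν) :
    adelicMpCont.l2Scaling F T hT ν p = c :=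
  adelicMpCont.lintegral_enorm_sq_omega_scalar_unique F ν T p (adelicMpCont.lintegral_enorm_sq_omega F T hT ν p) hc

/-- `l2Scaling ν 1 = 1`. [cite: Weil1964, Chap. I n° 13 p. 160] -/
theorem adelicMpCont.l2Scaling_one : adelicMpCont.l2Scaling F T hT ν 1 = 1 :=
  adelicMpCont.l2Scaling_eq_of_forall F T hT ν 1 fun Φ => by
    rw [adelicMpCont.omega_one_apply, one_mul]

/-- `l2Scaling ν p⁻¹ = (l2Scaling ν p)⁻¹`. [cite: Weil1964, Chap. I n° 13 p. 160] -/
theorem adelicMpCont.l2Scaling_inv (p : adelicMpCont F (Fin n) T) :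
    adelicMpCont.l2Scaling F T hT ν p⁻¹ = (adelicMpCont.l2Scaling F T hT ν p)⁻¹ := by
  have h : adelicMpCont.l2Scaling F T hT ν p * adelicMpCont.l2Scaling F T hT ν p⁻¹ = 1 := by
    rw [← adelicMpCont.l2Scaling_mul, mul_inv_cancel, adelicMpCont.l2Scaling_one]
  calc adelicMpCont.l2Scaling F T hT ν p⁻¹
      = (adelicMpCont.l2Scaling F T hT ν p)⁻¹ *
          (adelicMpCont.l2Scaling F T hT ν p * adelicMpCont.l2Scaling F T hT ν p⁻¹) := by
        rw [← mul_assoc, ENNReal.inv_mul_cancel (adelicMpCont.l2Scaling_ne_zero F T hT ν p)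
          (adelicMpCont.l2Scaling_ne_top F T hT ν p), one_mul]
    _ = (adelicMpCont.l2Scaling F T hT ν p)⁻¹ := by rw [h, mul_one]

/-- **`L²`-isometry from scaling `1`**: `l2Scaling ν p = 1` ⇒ `∫⁻ ‖ω(p)Φ‖ₑ² dν = ∫⁻ ‖Φ‖ₑ² dν` for every `Φ ∈ 𝒮(𝔸_Fⁿ)` — the
shape of the unitarity hypothesis `hiso` of `Li1992.RallisInnerProductFormulaUnitaryDualPair`. [cite: Weil1964, Chap. I n° 13 p. 160] -/
theorem adelicMpCont.lintegral_enorm_sq_omega_eq_of_l2Scaling_eq_one {p : adelicMpCont F (Fin n) T}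
    (hp : adelicMpCont.l2Scaling F T hT ν p = 1) (Φ : piSchwartzBruhat F (Fin n)) :
    ∫⁻ x, ‖((adelicMpCont.omega F (Fin n) T p Φ : piSchwartzBruhat F (Fin n)) :
        (Fin n → AdeleRing (𝓞 F) F) → ℂ) x‖ₑ ^ 2 ∂ν =
      ∫⁻ x, ‖(Φ : (Fin n → AdeleRing (𝓞 F) F) → ℂ) x‖ₑ ^ 2 ∂ν := by
  rw [adelicMpCont.lintegral_enorm_sq_omega F T hT ν p Φ, hp, one_mul]

end ReadOff

/-! ## §2 The scalings of the three generator families (adelic parameters) and the product formula -/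

section Generators

omit [MeasurableSpace (AdeleRing (𝓞 F) F)] [BorelSpace (AdeleRing (𝓞 F) F)] in
/-- **PRODUCT FORMULA for `det`**: `|det γ|_𝔸 = 1` for a RATIONAL `γ ∈ GL_n(F)` viewed in `GL_n(𝔸_F)` (`ratGL`): `det γ` is a
principal idèle (`ideleNorm_principal`). [cite: WeilBNT1967, Ch. IV §4 Thm 5] -/
theorem adelicAbsDet_ratGL (γ : GL (Fin n) F) : adelicAbsDet n F (ratGL F γ) = 1 := by
  rw [adelicAbsDet_apply]
  refine ideleNorm_principal ?_
  change Matrix.GeneralLinearGroup.det (Matrix.GeneralLinearGroup.map (algebraMap F (AdeleRing (𝓞 F) F)) γ) ∈ _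
  rw [Matrix.GeneralLinearGroup.map_det]
  exact ⟨Matrix.GeneralLinearGroup.det γ, rfl⟩

include hT in
/-- **Levi pairs**: `l2Scaling ν (m(a), Φ ↦ Φ ∘ a⁻¹) = |det ((a⁻¹)ᵀ)⁻¹|_𝔸 = |det a|_𝔸` for `a ∈ GL_n(𝔸_F)` — the module of the
row-vector twist by `(a⁻¹)ᵀ` (`coe_toOp_leviPair`, `lintegral_enorm_sq_twist`). [cite: Weil1964, Chap. I n° 13 p. 160]
[cite: WeilBNT1967, Ch. IV §3 Cor. 1] -/
theorem adelicMpCont.l2Scaling_leviPair (a : GL (Fin n) (AdeleRing (𝓞 F) F)) :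
    adelicMpCont.l2Scaling F T hT ν ⟨leviPair F T hT a, leviPair_mem_adelicMpCont F T hT a⟩ =
      ((adelicAbsDet n F (trInv a)⁻¹ : ℝ≥0) : ℝ≥0∞) :=
  adelicMpCont.l2Scaling_eq_of_forall F T hT ν _ fun Φ =>
    (lintegral_enorm_sq_congr_coe F ν (coe_toOp_leviPair F T hT a Φ)).trans (lintegral_enorm_sq_twist F ν (trInv a) Φ)

include hT in
/-- **unipotent pairs**: `l2Scaling ν (v(c), chirp(-½c)) = 1` for `c ∈ Sym_n(𝔸_F)` — the second-degree character is a unimodular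
multiplier (`coe_toOp_unipPair`, `lintegral_enorm_sq_chirp`). [cite: Weil1964, Chap. I n° 13 p. 160] -/
theorem adelicMpCont.l2Scaling_unipPair (c : Matrix (Fin n) (Fin n) (AdeleRing (𝓞 F) F)) (hc : c.IsSymm) :
    adelicMpCont.l2Scaling F T hT ν ⟨unipPair F T hT c hc, unipPair_mem_adelicMpCont F T hT c hc⟩ = 1 :=
  adelicMpCont.l2Scaling_eq_of_forall F T hT ν _ fun Φ =>
    (lintegral_enorm_sq_congr_coe F ν (coe_toOp_unipPair F T hT c hc Φ)).trans
      ((lintegral_enorm_sq_chirp F ν _ _).trans (one_mul _).symm)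

include hT in
/-- **the Weyl pair of a self-dual measure `ν₀`**: `l2Scaling ν (J_T, Φ ↦ Φ̂(-·)) = 1` for EVERY additive Haar measure `ν`
(`coe_fourierEquiv_symm`, adelic Plancherel `lintegral_enorm_sq_adelicPiFourier_neg`). [cite: Weil1964, Chap. I n° 13 p. 160]
[cite: CasselsFrohlichANT1967, Ch. XV Thm. 4.1.2] -/
theorem adelicMpCont.l2Scaling_weylPair (ν₀ : Measure (Fin n → AdeleRing (𝓞 F) F)) [ν₀.IsAddHaarMeasure]
    (hν₀ : ν₀ (piFundamentalDomain F (Fin n)) = 1) :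
    adelicMpCont.l2Scaling F T hT ν ⟨weylPair F T hT ν₀ hν₀, weylPair_mem_adelicMpCont F T hT ν₀ hν₀⟩ = 1 :=
  adelicMpCont.l2Scaling_eq_of_forall F T hT ν _ fun Φ =>
    (lintegral_enorm_sq_congr_coe F ν (coe_fourierEquiv_symm hν₀ Φ)).trans
      ((lintegral_enorm_sq_adelicPiFourier_neg F ν ν₀ hν₀ Φ.2).trans (one_mul _).symm)

end Generators

/-! ## §3 Weil's `r_F` is `L²(ν)`-isometric -/

section Rational

/-- **rational Levi generators**: `l2Scaling ν (r_F (m(γ))) = 1` for `γ ∈ GL_n(F)` — `r_F(m(γ)) = (m(γ), Φ ↦ Φ ∘ γ⁻¹)`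
(`coe_ratThetaLiftCont_levi`) of module `|det γ|_𝔸⁻¹ = 1` (product formula `adelicAbsDet_ratGL`).
[cite: Weil1964, Chap. I n° 13 p. 160, Chap. III n° 40 p. 190] [cite: WeilBNT1967, Ch. IV §4 Thm 5] -/
theorem adelicMpCont.l2Scaling_ratThetaLiftCont_levi (γ : GL (Fin n) F) :
    adelicMpCont.l2Scaling F T hT ν (ratThetaLiftCont F T hT (levi γ)) = 1 := by
  have h : ratThetaLiftCont F T hT (levi γ) =
      ⟨leviPair F T hT (ratGL F γ), leviPair_mem_adelicMpCont F T hT (ratGL F γ)⟩ :=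
    Subtype.ext (coe_ratThetaLiftCont_levi F T hT γ)
  have h2 : (trInv (ratGL F γ))⁻¹ = ratGL F (trInv γ)⁻¹ :=
    (congrArg Inv.inv (trInv_map (algebraMap F (AdeleRing (𝓞 F) F)) γ)).trans
      (map_inv (Matrix.GeneralLinearGroup.map (algebraMap F (AdeleRing (𝓞 F) F))) (trInv γ)).symm
  rw [h, adelicMpCont.l2Scaling_leviPair, h2, adelicAbsDet_ratGL, ENNReal.coe_one]

/-- **rational unipotent generators**: `l2Scaling ν (r_F (v(σ))) = 1` for `σ ∈ Sym_n(F)` — `r_F(v(σ))` is a unimodular chirp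
(`coe_ratThetaLiftCont_low`). [cite: Weil1964, Chap. I n° 13 p. 160, Chap. III n° 40 p. 190] -/
theorem adelicMpCont.l2Scaling_ratThetaLiftCont_low (σ : Matrix (Fin n) (Fin n) F) (hσ : σ.IsSymm) :
    adelicMpCont.l2Scaling F T hT ν (ratThetaLiftCont F T hT (low σ hσ)) = 1 := by
  have h : ratThetaLiftCont F T hT (low σ hσ) =
      ⟨unipPair F T hT (ratMatrix F σ) (hσ.map _), unipPair_mem_adelicMpCont F T hT (ratMatrix F σ) (hσ.map _)⟩ :=
    Subtype.ext (coe_ratThetaLiftCont_low F T hT σ hσ)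
  rw [h, adelicMpCont.l2Scaling_unipPair]

/-- **the Weyl element**: `l2Scaling ν (r_F J) = 1` — `r_F(J) = (J_T, Φ ↦ Φ̂(-·))` for any self-dual Haar measure `ν₀`
(`coe_ratThetaLiftCont_J`), isometric for every `ν` by Plancherel. [cite: Weil1964, Chap. I n° 13 p. 160, Chap. III n° 40 p. 190]
[cite: CasselsFrohlichANT1967, Ch. XV Thm. 4.1.2] -/
theorem adelicMpCont.l2Scaling_ratThetaLiftCont_J (ν₀ : Measure (Fin n → AdeleRing (𝓞 F) F)) [ν₀.IsAddHaarMeasure]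
    (hν₀ : ν₀ (piFundamentalDomain F (Fin n)) = 1) :
    adelicMpCont.l2Scaling F T hT ν (ratThetaLiftCont F T hT (SymplecticGroup.symJ (Fin n) F)) = 1 := by
  have h : ratThetaLiftCont F T hT (SymplecticGroup.symJ (Fin n) F) =
      ⟨weylPair F T hT ν₀ hν₀, weylPair_mem_adelicMpCont F T hT ν₀ hν₀⟩ :=
    Subtype.ext (coe_ratThetaLiftCont_J F T hT ν₀ hν₀)
  rw [h, adelicMpCont.l2Scaling_weylPair]

/-- **MAIN THEOREM — WEIL'S `r_F` IS `L²`-ISOMETRIC**: `l2Scaling ν (r_F γ) = 1` for every `γ ∈ Sp_{2n}(F)` and every additive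
Haar measure `ν` on `𝔸_Fⁿ`: the Θ-fixing LF-continuous lifts of the rational symplectic group act on `𝒮(𝔸_Fⁿ)` by
`L²(ν)`-isometries.  Proof: `γ ↦ l2Scaling ν (r_F γ)` is multiplicative (`l2Scaling_mul`), so its fibre over `1` is a subgroup
of `Sp_{2n}(F)`; it contains the generators `m(γ)`, `v(σ)`, `J` (§3), hence everything (`SymplecticMatrix.eq_top_of_generators_mem'`).
In print `r_k(σ)` is unitary by construction; in the tree's `ℂˣ`-extension `Mp_ψ(W_𝔸)ᶜᵒⁿᵗ` this is the statement that the
Θ-rigid normalisation kills the positive scalars on `Sp(W)(F)`. [cite: Weil1964, Chap. I n° 13 p. 160, Chap. III n° 40 p. 190,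
n° 41 Thm 6 p. 193] [cite: MoeglinVignerasWaldspurger1987, Chap. 2 II.5] -/
theorem adelicMpCont.l2Scaling_ratThetaLiftCont (γ : Matrix.symplecticGroup (Fin n) F) :
    adelicMpCont.l2Scaling F T hT ν (ratThetaLiftCont F T hT γ) = 1 := by
  obtain ⟨ν₀, hν₀H, hν₀⟩ := exists_haar_measure_piFundamentalDomain_eq_one F (n := n)
  haveI := hν₀H
  -- the `L²` scaling along `r_F` (the big operator terms are kept out of `rw` motives: `congrArg`/`trans` chains)
  let φ : Matrix.symplecticGroup (Fin n) F → ℝ≥0∞ := fun γ => adelicMpCont.l2Scaling F T hT ν (ratThetaLiftCont F T hT γ)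
  have hφmul : ∀ a b, φ (a * b) = φ a * φ b := fun a b =>
    (congrArg (adelicMpCont.l2Scaling F T hT ν) (map_mul (ratThetaLiftCont F T hT) a b)).trans
      (adelicMpCont.l2Scaling_mul F T hT ν _ _)
  have hφone : φ 1 = 1 :=
    (congrArg (adelicMpCont.l2Scaling F T hT ν) (map_one (ratThetaLiftCont F T hT))).trans
      (adelicMpCont.l2Scaling_one F T hT ν)
  have hφinv : ∀ a, φ a⁻¹ = (φ a)⁻¹ := fun a =>
    (congrArg (adelicMpCont.l2Scaling F T hT ν) (map_inv (ratThetaLiftCont F T hT) a)).trans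
      (adelicMpCont.l2Scaling_inv F T hT ν _)
  let H : Subgroup (Matrix.symplecticGroup (Fin n) F) :=
    { carrier := {γ | φ γ = 1}
      mul_mem' := fun {a b} ha hb => by
        have ha' : φ a = 1 := ha
        have hb' : φ b = 1 := hb
        show φ (a * b) = 1
        rw [hφmul, ha', hb', one_mul]
      one_mem' := hφone
      inv_mem' := fun {a} ha => by
        have ha' : φ a = 1 := ha
        show φ a⁻¹ = 1
        rw [hφinv, ha', inv_one] }
  have hm : ∀ a : GL (Fin n) F, levi a ∈ H := fun a =>
    show φ (levi a) = 1 from adelicMpCont.l2Scaling_ratThetaLiftCont_levi F T hT ν a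
  have hv : ∀ (c : Matrix (Fin n) (Fin n) F) (hc : c.IsSymm), low c hc ∈ H := fun c hc =>
    show φ (low c hc) = 1 from adelicMpCont.l2Scaling_ratThetaLiftCont_low F T hT ν c hc
  have hJ : SymplecticGroup.symJ (Fin n) F ∈ H :=
    show φ (SymplecticGroup.symJ (Fin n) F) = 1 from adelicMpCont.l2Scaling_ratThetaLiftCont_J F T hT ν ν₀ hν₀
  have hH : H = ⊤ := eq_top_of_generators_mem' hm hv hJ
  have hγ : γ ∈ H := by rw [hH]; exact Subgroup.mem_top γ
  exact hγ

/-- **`∫⁻ ‖ω(r_F γ)Φ‖ₑ² dν = ∫⁻ ‖Φ‖ₑ² dν`** for `γ ∈ Sp_{2n}(F)`, `Φ ∈ 𝒮(𝔸_Fⁿ)` — the consumer's (`hiso`) shape.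
[cite: Weil1964, Chap. I n° 13 p. 160, Chap. III n° 40 p. 190] -/
theorem adelicMpCont.lintegral_enorm_sq_omega_ratThetaLiftCont (γ : Matrix.symplecticGroup (Fin n) F)
    (Φ : piSchwartzBruhat F (Fin n)) :
    ∫⁻ x, ‖((adelicMpCont.omega F (Fin n) T (ratThetaLiftCont F T hT γ) Φ : piSchwartzBruhat F (Fin n)) :
        (Fin n → AdeleRing (𝓞 F) F) → ℂ) x‖ₑ ^ 2 ∂ν =
      ∫⁻ x, ‖(Φ : (Fin n → AdeleRing (𝓞 F) F) → ℂ) x‖ₑ ^ 2 ∂ν :=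
  adelicMpCont.lintegral_enorm_sq_omega_eq_of_l2Scaling_eq_one F T hT ν
    (adelicMpCont.l2Scaling_ratThetaLiftCont F T hT ν γ) Φ

/-- **range form**: every element of `r_F(Sp_{2n}(F)) ≤ Mp_ψ(W_𝔸)ᶜᵒⁿᵗ` has `L²` scaling `1` — the values a COMPATIBLE splitting
([GelbartRogawski1991, Prop. 3.1.1]: `s(G(F)) ⊆ i(Sp_F(W))`) takes on rational points.
[cite: GelbartRogawski1991, §3.1 p. 454, Prop. 3.1.1 p. 455] [cite: Weil1964, Chap. III n° 40 p. 190] -/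
theorem adelicMpCont.l2Scaling_eq_one_of_mem_range_ratThetaLiftCont {p : adelicMpCont F (Fin n) T}
    (hp : p ∈ (ratThetaLiftCont F T hT).range) : adelicMpCont.l2Scaling F T hT ν p = 1 := by
  obtain ⟨γ, rfl⟩ := hp
  exact adelicMpCont.l2Scaling_ratThetaLiftCont F T hT ν γ

/-- **Θ-rigid form**: an LF-continuous pair `p ∈ Mp_ψ(W_𝔸)ᶜᵒⁿᵗ` whose operator FIXES `Θ` and which lies over a RATIONAL point
`π(p) ∈ ratSp(Sp_{2n}(F))` is `L²(ν)`-isometric — it IS `r_F` of that point (`coe_ratThetaLiftCont_eq`).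
[cite: Weil1964, Chap. III n° 40 p. 190, n° 41 Thm 6 p. 193] -/
theorem adelicMpCont.l2Scaling_eq_one_of_mem_adelicMpTheta {p : adelicMpCont F (Fin n) T}
    (hΘ : (p : adelicMp F (Fin n) T) ∈ adelicMpTheta F (Fin n) T)
    (hp : adelicMpCont.proj F (Fin n) T p ∈ (ratSp F T hT).range) : adelicMpCont.l2Scaling F T hT ν p = 1 := by
  obtain ⟨γ, hγ⟩ := hp
  have e : ratThetaLiftCont F T hT γ = p :=
    Subtype.ext (coe_ratThetaLiftCont_eq F T hT hΘ ((adelicMpCont.proj_apply p).symm.trans hγ.symm))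
  rw [← e]
  exact adelicMpCont.l2Scaling_ratThetaLiftCont F T hT ν γ

/-- arbitrary-index form on `Fin n`: `l2Scaling ν (ratThetaLiftContι γ) = 1` (`ratThetaLiftContι_fin`).
[cite: Weil1964, Chap. III n° 40 p. 190] -/
theorem adelicMpCont.l2Scaling_ratThetaLiftContι (γ : Matrix.symplecticGroup (Fin n) F) :
    adelicMpCont.l2Scaling F T hT ν (ratThetaLiftContι F (Fin n) T hT γ) = 1 := by
  rw [ratThetaLiftContι_fin]
  exact adelicMpCont.l2Scaling_ratThetaLiftCont F T hT ν γ

/-- **on the subgroup of rational points of `Sp(W_𝔸)`**: `l2Scaling ν (r_F h) = 1` for every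
`h ∈ range (transportSp T ∘ mapHom ι_𝔸)` (`ratPointsThetaLiftCont`, the form in which a rational ELEMENT of `Sp(W_𝔸)` is lifted).
[cite: GelbartRogawski1991, §3.1 p. 454] [cite: Weil1964, Chap. III n° 40 p. 190] -/
theorem adelicMpCont.l2Scaling_ratPointsThetaLiftCont
    (g : ((transportSp T hT).comp (mapHom (algebraMap F (AdeleRing (𝓞 F) F)))).range) :
    adelicMpCont.l2Scaling F T hT ν (ratPointsThetaLiftCont F (Fin n) T hT g) = 1 := by
  rw [ratPointsThetaLiftCont_apply]
  exact adelicMpCont.l2Scaling_ratThetaLiftContι F T hT ν _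

end Rational

end Literature.NumberTheory.Weil1964

end
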